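import Summits.QuantumFields.GaugeBoot.PeriodicPlaquetteInsertion
import Summits.QuantumFields.GaugeBoot.ClassBWords
import HarnessLib

/-!
# `ℤ^d` as a periodic lattice: word calculus and the derivative of the one-link boundary action (gauge-boot, `ℤ^d` loop equations 1/4)

HONEST FRAMING (cell `pub-gaugeboot`, page 1 of every file): the venture produces certified bounds
on lattice expectations at stated coupling, gauge group, dimension and torus size; NOT a mass gap,
NOT a continuum limit, NOT a string tension; NOT Yang–Mills-summit-bearing (barriers
`FixedCouplingUltralocality`, `PerturbativeInvisibility`).

The Class-B interface (`ClassB.lean`) promises that a loop-equation SDP certificate bounds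
`∫ u_P dω` for every Class-B state `ω`; its `H`-side needs the single-link loop (Schwinger–Dyson)
equations for EVERY Haar-shift state on the infinite lattice `ℤ^d` (`IsHaarShiftState`), which
`ClassB.lean`, `ClassBWords.lean` and `TiltedBoxLimitLoopEquation.lean` all defer ("to be typed over
`LGConfig`"). This is file 1/4 of that derivation. The point: the tree's `ℤ^d` configurations
`LGConfig d G = ZdEdge d → G` ARE the configurations `TiltedRP.Config (Site d) d G` of the periodic
lattice `(A, e) = (ℤ^d, zdUnit)` (`zdUnit k = e_k`), definitionally, and `ZdPlaquette d` is
`TiltedRP.Plaq (Site d) d`; so the purely algebraic periodic word calculus (`PeriodicWords.lean`,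
`PeriodicWordDerivative.lean`, the local parts of `PeriodicPlaquetteInsertion.lean`) applies verbatim.
What the infinite lattice changes is the ACTION: there is no total Wilson action, only the boundary
action `wilsonBoundaryAction ρ {l}` of the `2(d−1)` plaquettes through the link `l`
(`Literature.MathematicalPhysics.QuantumLattice.LatticeGaugeDLR`), which is what `IsHaarShiftState`
tilts by. Contents:

* `zdUnit d` and the identifications `Step.move = Step.applyZd`, `Step.link = Step.edgeZd`,
  `Word.endpoint = Word.endpointZd`, `stepHolonomy = stepHolonomyZd`, `wordHolonomy = wordHolonomyZd`
  (the `ℤ^d` word layer of `ClassBWords.lean`), `holonomy = plaquetteHolonomyZd`, `plaqObs = plaquetteObs`;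
* `actionDerivZd ρ l X U := −Σ_{p ∋ l} Re tr(insDeriv_p)` — the flow derivative of the boundary action
  `S_{l}` along the one-link left shift `U ↦ U[l ↦ k(t)U_l]`, `ρ(k t) = exp(tX)`
  (`hasDerivAt_wilsonBoundaryAction`, `continuous_actionDerivZd`);
* RE-INDEXING over the finite set `plaquettesTouching {l}` (each plaquette through `l = (x, μ)`
  contributes once per slot, re-oriented to start with `l`: `sum_trace_insDeriv_plaquettesTouching`)
  and, for skew-Hermitian `X` and unitary `ρ`, `actionDerivZd = −½·plaqIns` with the SAME local
  functional `plaqIns ρ zdUnit X U x μ` as on every periodic lattice (`actionDerivZd_eq_plaqIns`).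

Everything is `[folklore]` (finite sums, trace cyclicity, Leibniz rule); no measure theory here.

References: M. Creutz, *Quarks, gluons and lattices* (1983) Ch. 11; S. Chatterjee, Comm. Math.
Phys. 366 (2019) §8 (lattice Makeenko–Migdal / Schwinger–Dyson equations); E. Seiler, LNP 159 (1982)
Ch. 2 (the one-link DLR kernel of lattice gauge theory); S. Cao, M. Park, S. Sheffield, Comm. AMS 5
(2025), Thm. 5.7 (`U(N)`) / Thm. 6.104 (`SU(N)`) (arXiv:2307.06790 numbering; informally Thm. 1.14).
-/

noncomputable section

open MeasureTheory Filter Topology NormedSpace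
open scoped Matrix.Norms.Frobenius Matrix
open Literature.Probability.LatticeModels (Site)
open Literature.MathematicalPhysics.QuantumLattice (LGConfig ZdEdge ZdPlaquette plaquetteHolonomyZd
  plaquetteObs plaquetteEdges plaquettesTouching mem_plaquettesTouching_iff wilsonBoundaryAction)
open Summit.QuantumFields.YangMills.Cruxes.CurvatureAmnesia.WardDefect.SchwingerDyson (hasDerivAt_reTrace)

namespace Summit.QuantumFields.GaugeBoot

namespace TiltedRP

/-! ### `ℤ^d` as the periodic lattice `(ℤ^d, zdUnit)` -/

section ZdUnit

variable (d : ℕ)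

/-- The marked translations of the infinite lattice `ℤ^d` viewed as a periodic lattice `(A, e)` with
`A = Site d = ℤ^d`: the unit vectors `e_k`. [folklore] -/
def zdUnit : Fin d → Site d := fun k => Pi.single k 1

variable {d} {N : ℕ} {G : Type} [Group G]

/-- Unfolding lemma `zdUnit_apply`. [folklore] -/
@[simp] theorem zdUnit_apply (k : Fin d) : zdUnit d k = Pi.single k 1 := rfl

/-- On `ℤ^d`, `Step.move zdUnit` is `Step.applyZd`. [folklore] -/
@[simp] theorem move_zdUnit (x : Site d) (s : Step d) : s.move (zdUnit d) x = s.applyZd x := by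
  cases s <;> rfl

/-- On `ℤ^d`, `Step.link zdUnit` is `Step.edgeZd`. [folklore] -/
@[simp] theorem link_zdUnit (x : Site d) (s : Step d) : s.link (zdUnit d) x = s.edgeZd x := by
  cases s <;> rfl

/-- On `ℤ^d`, the periodic endpoint is `Word.endpointZd`. [folklore] -/
@[simp] theorem endpoint_zdUnit (x : Site d) (w : Word d) :
    Word.endpoint (zdUnit d) x w = GaugeBoot.Word.endpointZd x w := by
  induction w generalizing x with
  | nil => rfl
  | cons s w ih => rw [Word.endpoint_cons, GaugeBoot.Word.endpointZd_cons, move_zdUnit, ih]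

/-- On `ℤ^d`, the periodic step holonomy is `stepHolonomyZd`. [folklore] -/
@[simp] theorem stepHolonomy_zdUnit (U : LGConfig d G) (x : Site d) (s : Step d) :
    stepHolonomy (zdUnit d) U x s = stepHolonomyZd U x s := by
  cases s <;> rfl

/-- On `ℤ^d`, the periodic word holonomy is `wordHolonomyZd` (`ClassBWords.lean`). [folklore] -/
@[simp] theorem wordHolonomy_zdUnit (U : LGConfig d G) (x : Site d) (w : Word d) :
    wordHolonomy (zdUnit d) U x w = wordHolonomyZd U x w := by
  induction w generalizing x with
  | nil => rfl
  | cons s w ih => rw [wordHolonomy_cons, wordHolonomyZd_cons, stepHolonomy_zdUnit, move_zdUnit, ih]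

/-- On `ℤ^d`, the periodic plaquette holonomy is `plaquetteHolonomyZd`. [folklore] -/
theorem holonomy_zdUnit (U : LGConfig d G) (x : Site d) (i j : Fin d) :
    holonomy (zdUnit d) U x i j = plaquetteHolonomyZd U x i j := rfl

variable (ρ : G →* Matrix (Fin N) (Fin N) ℂ)

/-- On `ℤ^d`, the periodic plaquette observable is `plaquetteObs`. [folklore] -/
theorem plaqObs_zdUnit (p : ZdPlaquette d) (U : LGConfig d G) :
    plaqObs ρ (zdUnit d) p U = plaquetteObs ρ p.1 p.2.1.1 p.2.1.2 U := rfl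

/-- The boundary Wilson action of `{l}` in periodic-lattice notation:
`S_{l}(U) = Σ_{p ∋ l} (N − plaqObs ρ zdUnit p U)`. [folklore] -/
theorem wilsonBoundaryAction_eq_sum_plaqObs (Λ : Finset (ZdEdge d)) (U : LGConfig d G) :
    wilsonBoundaryAction ρ Λ U = ∑ p ∈ plaquettesTouching Λ, ((N : ℝ) - plaqObs ρ (zdUnit d) p U) := rfl

end ZdUnit

/-! ### The derivative of the boundary action along the one-link shift -/

section ActionDeriv

variable {d N : ℕ} {G : Type} [Group G] (ρ : G →* Matrix (Fin N) (Fin N) ℂ) (l : ZdEdge d)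
  (X : Matrix (Fin N) (Fin N) ℂ) {k : ℝ → G}

/-- The flow derivative of the boundary Wilson action `S_{l} = Σ_{p ∋ l} (N − Re tr ρ(U_p))` of `ℤ^d`
along the one-link left shift at `l` in direction `X`: minus the real parts of the insertion
derivatives of the plaquette words through `l`. [folklore] -/
def actionDerivZd (U : LGConfig d G) : ℝ :=
  -∑ p ∈ plaquettesTouching ({l} : Finset (ZdEdge d)),
    ((insDeriv ρ (zdUnit d) l X U p.1 (Word.plaquette p.2.1.1 p.2.1.2)).trace).re

variable {ρ X}

/-- **The boundary action `S_{l}` is differentiable along the one-link shift at `l`, with derivative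
`actionDerivZd`.** [folklore] -/
theorem hasDerivAt_wilsonBoundaryAction (hk : ∀ s t, k (s + t) = k s * k t)
    (hX : ∀ t, ρ (k t) = exp ((t : ℂ) • X)) (U : LGConfig d G) :
    HasDerivAt (fun t : ℝ => wilsonBoundaryAction ρ {l} (Function.update U l (k t * U l)))
      (actionDerivZd ρ l X U) 0 := by
  unfold actionDerivZd
  simp only [wilsonBoundaryAction_eq_sum_plaqObs]
  rw [← Finset.sum_neg_distrib]
  refine HasDerivAt.fun_sum fun p _ => ?_
  have h := (hasDerivAt_reTrace (hasDerivAt_wordHolonomy (zdUnit d) l hk hX U p.1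
    (Word.plaquette p.2.1.1 p.2.1.2))).const_sub (N : ℝ)
  simpa only [wordHolonomy_plaquette, plaqObs] using h

/-- `actionDerivZd` is continuous in the configuration (for continuous `ρ`). [folklore] -/
theorem continuous_actionDerivZd [TopologicalSpace G] [IsTopologicalGroup G] (hρ : Continuous ρ) :
    Continuous fun U : LGConfig d G => actionDerivZd ρ l X U := by
  unfold actionDerivZd
  refine (continuous_finsetSum _ fun p _ => ?_).neg
  exact Complex.continuous_re.comp ((continuous_insDeriv (zdUnit d) l hρ p.1 _).matrix_trace)

end ActionDeriv

/-! ### Re-indexing the sum over the plaquettes through a link -/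

section Collapse

variable {d : ℕ} {M : Type*} [AddCommMonoid M]

/-- The base points of the plaquettes that may contain a link at `x`: `x` itself and the `x − e_ν`.
[folklore] -/
def plaqBase (x : Site d) : Finset (Site d) :=
  insert x (Finset.univ.image fun ν : Fin d => x - zdUnit d ν)

/-- `x ∈ plaqBase x`. [folklore] -/
theorem mem_plaqBase_self (x : Site d) : x ∈ plaqBase x := Finset.mem_insert_self _ _

/-- `x − e_ν ∈ plaqBase x`. [folklore] -/
theorem sub_mem_plaqBase (x : Site d) (ν : Fin d) : x - zdUnit d ν ∈ plaqBase x :=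
  Finset.mem_insert_of_mem (Finset.mem_image.2 ⟨ν, Finset.mem_univ _, rfl⟩)

/-- The plaquettes through `(x, μ)` have base point in `plaqBase x`. [folklore] -/
theorem plaquettesTouching_subset (x : Site d) (μ : Fin d) :
    plaquettesTouching ({(x, μ)} : Finset (ZdEdge d)) ⊆ plaqBase x ×ˢ Finset.univ := by
  intro p hp
  obtain ⟨e, he⟩ := mem_plaquettesTouching_iff.1 hp
  rw [Finset.mem_inter, Finset.mem_singleton] at he
  obtain ⟨he1, rfl⟩ := he
  refine Finset.mem_product.2 ⟨?_, Finset.mem_univ _⟩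
  simp only [plaquetteEdges, Finset.mem_insert, Finset.mem_singleton, Prod.mk.injEq] at he1
  rcases he1 with ⟨h, -⟩ | ⟨h, -⟩ | ⟨h, -⟩ | ⟨h, -⟩
  · rw [h]; exact mem_plaqBase_self _
  · rw [show p.1 = x - zdUnit d p.2.1.1 by rw [h, zdUnit_apply, add_sub_cancel_right]]
    exact sub_mem_plaqBase _ _
  · rw [show p.1 = x - zdUnit d p.2.1.2 by rw [h, zdUnit_apply, add_sub_cancel_right]]
    exact sub_mem_plaqBase _ _
  · rw [h]; exact mem_plaqBase_self _

/-- A plaquette one of whose edges is `l` touches `{l}`. [folklore] -/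
theorem mem_plaquettesTouching_singleton {l : ZdEdge d} {p : ZdPlaquette d} (h : l ∈ plaquetteEdges p) :
    p ∈ plaquettesTouching ({l} : Finset (ZdEdge d)) :=
  mem_plaquettesTouching_iff.2 ⟨l, Finset.mem_inter.2 ⟨h, Finset.mem_singleton_self _⟩⟩

/-- A sum over the plaquettes through `(x, μ)` of terms supported on them may be taken over the
product `plaqBase x × DirPair d`. [folklore] -/
theorem sum_plaquettesTouching_ite (x : Site d) (μ : Fin d) (c : ZdPlaquette d → Prop) [DecidablePred c]
    (F : ZdPlaquette d → M) (hc : ∀ p, c p → p ∈ plaquettesTouching ({(x, μ)} : Finset (ZdEdge d))) :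
    ∑ p ∈ plaquettesTouching ({(x, μ)} : Finset (ZdEdge d)), (if c p then F p else 0) =
      ∑ p ∈ plaqBase x ×ˢ (Finset.univ : Finset (DirPair d)), (if c p then F p else 0) :=
  Finset.sum_subset (plaquettesTouching_subset x μ) fun p _ hp => by rw [if_neg fun h => hp (hc p h)]

/-- A sum over `B × DirPair d` as `Σ_{i<j} Σ_{y ∈ B}`. [folklore] -/
theorem sum_base_plaq_eq (B : Finset (Site d)) (f : Site d → Fin d → Fin d → M) :
    ∑ p ∈ B ×ˢ (Finset.univ : Finset (DirPair d)), f p.1 p.2.1.1 p.2.1.2 =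
      ∑ i : Fin d, ∑ j : Fin d, if i < j then ∑ y ∈ B, f y i j else 0 := by
  rw [Finset.sum_product, Finset.sum_comm]
  have h : ∑ q : DirPair d, ∑ y ∈ B, f y q.1.1 q.1.2 =
      ∑ p ∈ (Finset.univ : Finset (Fin d × Fin d)).filter (fun p => p.1 < p.2), ∑ y ∈ B, f y p.1 p.2 := by
    rw [← Finset.sum_subtype_eq_sum_filter, Finset.subtype_univ]
  rw [h, Finset.sum_filter, Fintype.sum_prod_type]

/-- `Σ_{y ∈ B} [y = x ∧ c] Φ(y) = [c] Φ(x)` for `x ∈ B`. [folklore] -/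
theorem sum_base_ite_and_eq {B : Finset (Site d)} {x : Site d} (hx : x ∈ B) (c : Prop) [Decidable c]
    (Φ : Site d → M) : ∑ y ∈ B, (if y = x ∧ c then Φ y else 0) = if c then Φ x else 0 := by
  by_cases hc : c
  · simp [hc, Finset.sum_ite_eq', hx]
  · simp [hc]

/-- `Σ_{y ∈ B} [y + e_i = x ∧ c] F(y + e_i) = [c] F(x)` for `x − e_i ∈ B`. [folklore] -/
theorem sum_base_ite_add_and_eq {B : Finset (Site d)} {x : Site d} (i : Fin d) (hx : x - zdUnit d i ∈ B)
    (c : Prop) [Decidable c] (F : Site d → Fin d → Fin d → M) (a b : Fin d) :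
    ∑ y ∈ B, (if y + zdUnit d i = x ∧ c then F (y + zdUnit d i) a b else 0) = if c then F x a b else 0 := by
  have h : ∀ y : Site d, (y + zdUnit d i = x ∧ c) = (y = x - zdUnit d i ∧ c) := fun y => by
    rw [eq_sub_iff_add_eq]
  simp only [h, sum_base_ite_and_eq hx c (fun y => F (y + zdUnit d i) a b), sub_add_cancel]

/-- [folklore] Collapse, slot 1: condition `(y, i) = (x, μ)`. -/
theorem collapseZd₀ (x : Site d) (μ : Fin d) (F : Site d → Fin d → Fin d → M) :
    ∑ p ∈ plaquettesTouching ({(x, μ)} : Finset (ZdEdge d)),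
        (if (p.1, p.2.1.1) = (x, μ) then F p.1 p.2.1.1 p.2.1.2 else 0) =
      ∑ ν : Fin d, if μ < ν then F x μ ν else 0 := by
  rw [sum_plaquettesTouching_ite x μ (fun p => (p.1, p.2.1.1) = (x, μ)) (fun p => F p.1 p.2.1.1 p.2.1.2)
    fun p h => ?_]
  · rw [sum_base_plaq_eq (plaqBase x) (fun y i j => if (y, i) = (x, μ) then F y i j else 0)]
    simp only [Prod.mk.injEq, sum_base_ite_and_eq (mem_plaqBase_self x)]
    exact sum_sum_ite_lt_eq_left μ (F x)
  · simp only [Prod.mk.injEq] at h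
    obtain ⟨h1, h2⟩ := h
    exact mem_plaquettesTouching_singleton (by simp [plaquetteEdges, h1, h2])

/-- [folklore] Collapse, slot 2: condition `(y + e_i, j) = (x, μ)`, summand through `y + e_i`. -/
theorem collapseZd₁ (x : Site d) (μ : Fin d) (F : Site d → Fin d → Fin d → M) :
    ∑ p ∈ plaquettesTouching ({(x, μ)} : Finset (ZdEdge d)),
        (if (p.1 + zdUnit d p.2.1.1, p.2.1.2) = (x, μ) then F (p.1 + zdUnit d p.2.1.1) p.2.1.1 p.2.1.2
          else 0) = ∑ ν : Fin d, if ν < μ then F x ν μ else 0 := by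
  rw [sum_plaquettesTouching_ite x μ (fun p => (p.1 + zdUnit d p.2.1.1, p.2.1.2) = (x, μ))
    (fun p => F (p.1 + zdUnit d p.2.1.1) p.2.1.1 p.2.1.2) fun p h => ?_]
  · rw [sum_base_plaq_eq (plaqBase x)
      (fun y i j => if (y + zdUnit d i, j) = (x, μ) then F (y + zdUnit d i) i j else 0)]
    have hs : ∀ i j : Fin d, (∑ y ∈ plaqBase x,
        if (y + zdUnit d i, j) = (x, μ) then F (y + zdUnit d i) i j else 0) =
        if j = μ then F x i j else 0 := fun i j => by
      simp only [Prod.mk.injEq]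
      exact sum_base_ite_add_and_eq i (sub_mem_plaqBase x i) (j = μ) F i j
    simp only [hs]
    exact sum_sum_ite_lt_eq_right μ (F x)
  · simp only [Prod.mk.injEq] at h
    obtain ⟨h1, h2⟩ := h
    exact mem_plaquettesTouching_singleton (by simp [plaquetteEdges, ← h1, h2])

/-- [folklore] Collapse, slot 3: condition `(y + e_j, i) = (x, μ)`, summand through `y + e_j`. -/
theorem collapseZd₂ (x : Site d) (μ : Fin d) (F : Site d → Fin d → Fin d → M) :
    ∑ p ∈ plaquettesTouching ({(x, μ)} : Finset (ZdEdge d)),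
        (if (p.1 + zdUnit d p.2.1.2, p.2.1.1) = (x, μ) then F (p.1 + zdUnit d p.2.1.2) p.2.1.1 p.2.1.2
          else 0) = ∑ ν : Fin d, if μ < ν then F x μ ν else 0 := by
  rw [sum_plaquettesTouching_ite x μ (fun p => (p.1 + zdUnit d p.2.1.2, p.2.1.1) = (x, μ))
    (fun p => F (p.1 + zdUnit d p.2.1.2) p.2.1.1 p.2.1.2) fun p h => ?_]
  · rw [sum_base_plaq_eq (plaqBase x)
      (fun y i j => if (y + zdUnit d j, i) = (x, μ) then F (y + zdUnit d j) i j else 0)]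
    have hs : ∀ i j : Fin d, (∑ y ∈ plaqBase x,
        if (y + zdUnit d j, i) = (x, μ) then F (y + zdUnit d j) i j else 0) =
        if i = μ then F x i j else 0 := fun i j => by
      simp only [Prod.mk.injEq]
      exact sum_base_ite_add_and_eq j (sub_mem_plaqBase x j) (i = μ) F i j
    simp only [hs]
    exact sum_sum_ite_lt_eq_left μ (F x)
  · simp only [Prod.mk.injEq] at h
    obtain ⟨h1, h2⟩ := h
    exact mem_plaquettesTouching_singleton (by simp [plaquetteEdges, ← h1, h2])

/-- [folklore] Collapse, slot 4: condition `(y, j) = (x, μ)`. -/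
theorem collapseZd₃ (x : Site d) (μ : Fin d) (F : Site d → Fin d → Fin d → M) :
    ∑ p ∈ plaquettesTouching ({(x, μ)} : Finset (ZdEdge d)),
        (if (p.1, p.2.1.2) = (x, μ) then F p.1 p.2.1.1 p.2.1.2 else 0) =
      ∑ ν : Fin d, if ν < μ then F x ν μ else 0 := by
  rw [sum_plaquettesTouching_ite x μ (fun p => (p.1, p.2.1.2) = (x, μ)) (fun p => F p.1 p.2.1.1 p.2.1.2)
    fun p h => ?_]
  · rw [sum_base_plaq_eq (plaqBase x) (fun y i j => if (y, j) = (x, μ) then F y i j else 0)]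
    simp only [Prod.mk.injEq, sum_base_ite_and_eq (mem_plaqBase_self x)]
    exact sum_sum_ite_lt_eq_right μ (F x)
  · simp only [Prod.mk.injEq] at h
    obtain ⟨h1, h2⟩ := h
    exact mem_plaquettesTouching_singleton (by simp [plaquetteEdges, h1, h2])

end Collapse

/-! ### Assembling: the plaquette sum in raw and in symmetric form -/

section Assembly

variable {d N : ℕ} {G : Type} [Group G] {ρ : G →* Matrix (Fin N) (Fin N) ℂ} {X : Matrix (Fin N) (Fin N) ℂ}

/-- **Raw plaquette-insertion sum on `ℤ^d`.** Summing the insertion derivatives of the plaquette words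
through the link `l = (x, μ)`: each plaquette contributes once per slot, re-oriented to start with `l`;
planes `(μ, ν)` with `μ < ν` through the slots 1 and 3, planes with `ν < μ` through the slots 2 and 4 —
the same right-hand side as on every finite periodic lattice (`sum_trace_insDeriv_plaq`). [folklore] -/
theorem sum_trace_insDeriv_plaquettesTouching (U : LGConfig d G) (x : Site d) (μ : Fin d) :
    ∑ p ∈ plaquettesTouching ({(x, μ)} : Finset (ZdEdge d)),
        (insDeriv ρ (zdUnit d) (x, μ) X U p.1 (Word.plaquette p.2.1.1 p.2.1.2)).trace =
      ∑ ν : Fin d, (if μ < ν then ((X * ρ (wordHolonomy (zdUnit d) U x (plaqWord μ ν true))).trace -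
          (X * ρ (wordHolonomy (zdUnit d) U x (plaqWord μ ν false).reverse)).trace) else 0) +
      ∑ ν : Fin d, (if ν < μ then ((X * ρ (wordHolonomy (zdUnit d) U x (plaqWord μ ν false))).trace -
          (X * ρ (wordHolonomy (zdUnit d) U x (plaqWord μ ν true).reverse)).trace) else 0) := by
  simp only [trace_insDeriv_plaquette, Finset.sum_sub_distrib, Finset.sum_add_distrib]
  rw [collapseZd₀ x μ (fun y i j => (X * ρ (wordHolonomy (zdUnit d) U y (Word.plaquette i j))).trace),
    collapseZd₁ x μ
      (fun z i j => (X * ρ (wordHolonomy (zdUnit d) U z [.fwd j, .bwd i, .bwd j, .fwd i])).trace),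
    collapseZd₂ x μ
      (fun z i j => (X * ρ (wordHolonomy (zdUnit d) U z [.bwd j, .fwd i, .fwd j, .bwd i])).trace),
    collapseZd₃ x μ (fun y i j => (X * ρ (wordHolonomy (zdUnit d) U y (Word.plaquette i j))).trace)]
  have hsplit : ∀ (c : Prop) [Decidable c] (a b : ℂ),
      (if c then a - b else 0) = (if c then a else 0) - (if c then b else 0) := by
    intros; split_ifs <;> simp
  simp only [hsplit, Finset.sum_sub_distrib, reverse_plaqWord_true, reverse_plaqWord_false]
  simp only [plaqWord_true, plaqWord_false]
  ring

/-- **The derivative of the boundary action along the shift, symmetric form**: for skew-Hermitian `X`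
and unitary `ρ`, `S'_{l}(U) = −½ · plaqIns ρ zdUnit X U x μ` — the SAME local plaquette-insertion
functional as on every periodic lattice. [folklore] -/
theorem actionDerivZd_eq_plaqIns (hX : Xᴴ = -X) (hρ : ∀ g, ρ g ∈ Matrix.unitaryGroup (Fin N) ℂ)
    (U : LGConfig d G) (x : Site d) (μ : Fin d) :
    ((actionDerivZd ρ (x, μ) X U : ℝ) : ℂ) = -(1 / 2) * plaqIns ρ (zdUnit d) X U x μ := by
  have hP : ∀ ν ε, ρ (wordHolonomy (zdUnit d) U x (plaqWord μ ν ε).reverse) =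
      (ρ (wordHolonomy (zdUnit d) U x (plaqWord μ ν ε)))ᴴ :=
    fun ν ε => rho_wordHolonomy_reverse (zdUnit d) hρ U x _ (endpoint_plaqWord (zdUnit d) x μ ν ε)
  unfold actionDerivZd plaqIns
  rw [← Complex.re_sum, sum_trace_insDeriv_plaquettesTouching, Complex.ofReal_neg, Complex.add_re,
    Complex.ofReal_add, Complex.re_sum, Complex.re_sum, Complex.ofReal_sum, Complex.ofReal_sum]
  simp only [apply_ite Complex.re, Complex.zero_re, apply_ite ((↑) : ℝ → ℂ), Complex.ofReal_zero,
    Complex.sub_re, Complex.ofReal_sub, hP, re_trace_skew_mul hX, Matrix.conjTranspose_conjTranspose,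
    Matrix.mul_sub, Matrix.trace_sub, Fintype.sum_bool]
  rw [← Finset.sum_add_distrib, Finset.mul_sum, ← Finset.sum_neg_distrib]
  rw [← Finset.sum_subset (Finset.subset_univ (Finset.univ.erase μ)) (fun ν _ hν => by
    have hν' : ν = μ := by simpa using hν
    subst hν'
    simp)]
  refine Finset.sum_congr rfl fun ν hν => ?_
  have hne : ν ≠ μ := Finset.ne_of_mem_erase hν
  rcases lt_or_gt_of_ne hne with h | h
  · simp only [h, if_true, not_lt.2 h.le, if_false]
    ring
  · simp only [h, if_true, not_lt.2 h.le, if_false]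
    ring

end Assembly

end TiltedRP

end Summit.QuantumFields.GaugeBoot

end
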